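import Summits.AtomisticToContinuum.HydrodynamicLimit.Theses.HeatBathForgetting

/-!
# Birth skeleton (BC3) for the crux `CubicMomentUI` (stmt-AtomisticToContinuum-9454), line `birth`

Route `HeatBathForgetting` (`Summits/AtomisticToContinuum/HydrodynamicLimit/Theses/HeatBathForgetting.lean`,
crux rank 3). The crux, read back: along the TRUE deterministic evolution from local Gibbs data
(`0 < σ < σ₀`, a classical hard-sphere Euler solution on `[0,T)`, fields converging at `t = 0`), for every
`t < T` and `δ > 0` there are `K₀, N₀` with
`E_{P_N}[(N+1)⁻¹ Σᵢ |vᵢ(s)|³ 1(|vᵢ(s)| > K₀)] ≤ δ` for all `N ≥ N₀`, `s ∈ [0,t]`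
(uniform integrability IN THE MEAN of the cubic velocity moment — the truncation input for the energy
current `(E+p)m/ρ` in cruxes `RefreshToClosure` / `ClosureToEntropy`).

## The line: QUARTIC TRANSFER (the moment method of kinetic theory, run on the `N`-body flow in the mean)

Uniform integrability of `|v|³` is an `L¹`-tail statement with no algebraic structure under hard-sphere
collisions. The QUARTIC empirical moment `Q_N(s) := E_{P_N}[(N+1)⁻¹ Σᵢ |vᵢ(s)|⁴]` has one: at an elastic
collision `(v,w) ↦ (v',w')`, `|v'|² + |w'|² = |v|² + |w|²` gives the EXACT increment
`Δ(|v|⁴ + |w|⁴) = 2(|v|²|w|² − |v'|²|w'|²) = 2(τ² − τ(E₁ − E₂))`, `τ := |w'|² − |w|²` the energy received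
by the partner, `E₁ = |v|², E₂ = |w|²`: the quartic sum DECREASES exactly when energy flows down the pair's
energy gradient by more than the square of the transfer — a fast particle hitting a slow one always lowers
it. This is the Povzner structure behind propagation (and creation) of polynomial moments for the
hard-sphere Boltzmann equation [Desvillettes 1993; Mischler–Wennberg 1999; Alonso–Cañizo–Gamba–Mouhot 2013,
arXiv:1203.6560] and, uniformly in `N`, for Kac's `N`-particle hard-sphere process [Mischler–Mouhot 2013,
arXiv:1107.3251, Thm 5.1/6.1 moment conditions]. Chebyshev at the level of ONE configuration,
`∫ |v|³ 1(K < |v|) dμ_z ≤ K⁻¹ ∫ |v|⁴ dμ_z` (`integral_cubicTail_le_quartic`, proved below), turns a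
uniform-in-`N` quartic bound along the flow into the crux with `K₀ = (e^{At} C₀ + B t)/δ + 1`.

Why easier / what it exposes (Transfer): the crux `C` is implied by the stronger `C⁺ = stub₁ ∧ stub₂`
(uniform quartic bound), and `C⁺` is the statement to which a NAMED tool applies — the exact quartic
collision identity above (time-integrated over the collision record of a good orbit:
`Σᵢ|vᵢ(s)|⁴ − Σᵢ|vᵢ(0)|⁴ = 2 Σ_{collisions ≤ s} (τ_c² − τ_c (E₁ − E₂)_c)`), so that `stub₂` is equivalent
to a one-sided FLUCTUATION–DISSIPATION inequality for the collision record,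
`E Σ_{c ≤ s} τ_c² ≤ E Σ_{c ≤ s} τ_c (E₁ − E₂)_c + ½ B (N+1) s` (energy transfers at collisions are, in the
mean, dissipative at least to second order — an identity with `B = 0` under detailed balance). No
exponential moment of the cubic current is ever formed (HighMomentumCutoffBarrierNarrow, conjunct (2):
those are infinite already for Maxwellians); the 4th moment is the weakest integer moment giving UI of
the 3rd.

## Stubs (2, registered) and composition

* `stub_initialQuarticMoment` — STATIC, true, size M (provable now): under the local Gibbs law the
  expected empirical quartic velocity moment is bounded uniformly in `N` and in the flow (given the
  positions the velocities are independent `N(u₀(xᵢ), θ₀(xᵢ)I₃)`, `lintegral_localGibbsMeasure`;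
  `E|u₀(x) + √θ₀(x) g|⁴ ≤ 8(‖u₀‖_∞⁴ + 15 ‖θ₀‖_∞²)`; `σ₀ = 1/2` for `isProbabilityMeasure_localGibbsLaw`).
* `stub_quarticPropagation` — DYNAMICAL, open, size L–XL (the crux's core in moment currency; same
  "why it might fail" as the crux: an energy cascade to a vanishing fraction of fast particles):
  Gronwall-shaped propagation `Q_N(s) ≤ e^{As} Q_N(0) + B s` for `N ≥ N₀`, `s ∈ [0,t]`, with `A, B ≥ 0`
  independent of `N` (at `s = 0` an identity a.e. by `HardSphereFlow.flow_zero` and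
  `localGibbsMeasure_absolutelyContinuous`).
* `CubicMomentUI_of (h1 : stub_initialQuarticMoment) (h2 : stub_quarticPropagation) : CubicMomentUI` —
  hypotheses are the stub statements by name (`def stub_* : Prop := type_of% Holds.stub_*`); kernel-checked, no `sorry`
  (Chebyshev at the empirical-measure level + `ℝ≥0∞` arithmetic; `σ₀ := min σ₀¹ σ₀²`).

Docking / dead lines: both stubs follow from the OPEN shared item `SpeedCapSurgery.GaussianVelocityTails`
(stmt-AtomisticToContinuum-9633 = stmt-4607, the body of `Literature.Barriers.AtomisticToContinuum.HighMomentumCutoff σ`)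
since `e^{c x²} ≥ c² x⁴ / 2`; a proof of 9633 closes this crux through this skeleton, but the line asks
for strictly less (one polynomial moment). Negatives index (20 entries, 2026-08-17): none is a moment
bound in the mean; `EulerCharacteristics.ExpTailBudget` (stmt-14607, refuted-misstated) died of asking an
`exp(−cN)` budget for the CUBIC tail at `t = 0` — both stubs here are expectations, finite at `t = 0`.
Disproof used: none on file (`Cruxes/CubicMomentUI/` had no workfiles at registration).
-/

noncomputable section

open MeasureTheory Set Filter Topology
open scoped ENNReal BigOperators

namespace Summit.AtomisticToContinuum.HydrodynamicLimit.Cruxes.CubicMomentUI.Birth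

open Literature.MathematicalPhysics.KineticTheory Literature.Analysis.FluidPDE
open Summit.AtomisticToContinuum.HydrodynamicLimit.Theses.HeatBathForgetting (CubicMomentUI)

/-! ## The registered stubs (D-0027 §3.3 shape: sorried theorems in `Holds`, statements by name, `_of`) -/

namespace Holds

/-- **Stub 1 (static; true, M).** INITIAL QUARTIC MOMENT: for continuous profiles `a₀, θ₀ > 0`, `u₀`
there is `σ₀ > 0` such that for `0 < σ < σ₀` some `C₀ ≥ 0` bounds, for every `N` and every flow `Φ`
(which only fixes the phase space, `localGibbsLaw_eq`), the local-Gibbs expectation of the empirical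
quartic velocity moment `(N+1)⁻¹ Σᵢ |vᵢ|⁴` (`integral_empiricalMeasure`). Velocities are conditionally
Gaussian given the positions (`lintegral_localGibbsMeasure`); `C₀ = 8(‖u₀‖_∞⁴ + 15‖θ₀‖_∞²)` works. -/
theorem stub_initialQuarticMoment :
    ∀ (a₀ θ₀ : Literature.MathematicalPhysics.KineticTheory.T3 → ℝ) (u₀ : Literature.MathematicalPhysics.KineticTheory.T3 → Literature.MathematicalPhysics.KineticTheory.V3), Continuous a₀ → Continuous θ₀ → Continuous u₀ → (∀ x, 0 < a₀ x) → (∀ x, 0 < θ₀ x) → ∃ σ₀ : ℝ, 0 < σ₀ ∧ ∀ σ : ℝ, 0 < σ → σ < σ₀ → ∃ C₀ : ℝ, 0 ≤ C₀ ∧ ∀ (N : ℕ) (Φ : Literature.Analysis.FluidPDE.HardSphereFlow (Literature.Analysis.FluidPDE.Torus.geometry (Fin 3)) (Literature.MathematicalPhysics.KineticTheory.hsDiameter σ N) (N + 1)), ∫⁻ z, ENNReal.ofReal (∫ y, ‖y.2‖ ^ 4 ∂(Literature.Analysis.FluidPDE.empiricalMeasure z)) ∂(Literature.MathematicalPhysics.KineticTheory.localGibbsLaw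 σ a₀ u₀ θ₀ N Φ) ≤ ENNReal.ofReal C₀ := by
  sorry

/-- **Stub 2 (dynamical; OPEN, L–XL — the load-bearing stub).** QUARTIC PROPAGATION ALONG THE TRUE
EVOLUTION, Gronwall-shaped and uniform in `N`: with the crux's prefix (local Gibbs data, `0 < σ < σ₀`,
classical Euler solution on `[0,T)`, fields converging at `t = 0`, `t < T`) there are `A, B ≥ 0` and `N₀`
with `Q_N(s) ≤ e^{As} Q_N(0) + B s` for all `N ≥ N₀`, `s ∈ [0,t]`, where
`Q_N(s) = ∫⁻ ofReal ((N+1)⁻¹ Σᵢ |vᵢ(Φ_N(s) z)|⁴) dP_N`. Intended mechanism: the exact quartic collision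
identity `Δ(|v|⁴+|w|⁴) = 2(τ² − τ(E₁−E₂))` summed over the collision record (Povzner structure), i.e. a
one-sided fluctuation–dissipation inequality for energy transfers at collisions in the mean. Why it
might fail: as the crux — only the total kinetic energy is conserved, and a conspiracy of collision
parameters funnelling energy into a vanishing fraction of particles is excluded by no known a-priori
estimate at fixed reduced density. -/
theorem stub_quarticPropagation :
    ∀ (a₀ θ₀ : Literature.MathematicalPhysics.KineticTheory.T3 → ℝ) (u₀ : Literature.MathematicalPhysics.KineticTheory.T3 → Literature.MathematicalPhysics.KineticTheory.V3), Continuous a₀ → Continuous θ₀ → Continuous u₀ → (∀ x, 0 < a₀ x) → (∀ x, 0 < θ₀ x) → ∃ σ₀ : ℝ, 0 < σ₀ ∧ ∀ σ : ℝ, 0 < σ → σ < σ₀ → ∀ (T : ℝ) (ρ θ : ℝ → Literature.MathematicalPhysics.KineticTheory.T3 → ℝ) (u : ℝ → Literature.MathematicalPhysics.KineticTheory.T3 → Literature.MathematicalPhysics.KineticTheory.V3), Literature.MathematicalPhysics.KineticTheory.IsHardSphereEulerSolution σ T ρ u θ → ∀ Φ : (N : ℕ) → Literature.Analysis.FluidPDE.HardSphereFlow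 (Literature.Analysis.FluidPDE.Torus.geometry (Fin 3)) (Literature.MathematicalPhysics.KineticTheory.hsDiameter σ N) (N + 1), Literature.MathematicalPhysics.KineticTheory.TendstoHydroFieldsAt (fun N => Literature.MathematicalPhysics.KineticTheory.localGibbsLaw σ a₀ u₀ θ₀ N (Φ N)) Φ ρ u θ 0 → ∀ t ∈ Set.Ico 0 T, ∃ A : ℝ, 0 ≤ A ∧ ∃ B : ℝ, 0 ≤ B ∧ ∃ N₀ : ℕ, ∀ N : ℕ, N₀ ≤ N → ∀ s ∈ Set.Icc 0 t, ∫⁻ z, ENNReal.ofReal (∫ y, ‖y.2‖ ^ 4 ∂(Literature.Analysis.FluidPDE.empiricalMeasure ((Φ N).flow s z))) ∂(Literature.MathematicalPhysics.KineticTheory.localGibbsLaw σ a₀ u₀ θ₀ N (Φ N)) ≤ ENNReal.ofReal (Real.exp (A * s)) * (∫⁻ z, ENNReal.ofReal (∫ y, ‖y.2‖ ^ 4 ∂(Literature.Analysis.FluidPDE.empiricalMeasure z)) ∂(Literature.MathematicalPhysics.KineticTheory.localGibbsLaw σ a₀ u₀ θ₀ N (Φ N))) + ENNReal.ofReal (B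 * s) := by
  sorry

end Holds

/-! ## The stub statements by name (hypotheses of `CubicMomentUI_of`) -/

/-- Statement of `Holds.stub_initialQuarticMoment` (registered stub 1). -/
def stub_initialQuarticMoment : Prop := type_of% Holds.stub_initialQuarticMoment

/-- Statement of `Holds.stub_quarticPropagation` (registered stub 2, load-bearing). -/
def stub_quarticPropagation : Prop := type_of% Holds.stub_quarticPropagation

/-! ## Proved glue -/

/-- Chebyshev at the level of one configuration: `∫ |v|³ 1(K < |v|) dμ_w ≤ K⁻¹ ∫ |v|⁴ dμ_w` for the
empirical measure `μ_w` of `w` and `K > 0` (both sides are finite averages, `integral_empiricalMeasure`). -/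
theorem integral_cubicTail_le_quartic {N : ℕ} (w : Config (N + 1) (Fin 3) T3) {K : ℝ} (hK : 0 < K) :
    ∫ y, (if K < ‖y.2‖ then ‖y.2‖ ^ 3 else 0) ∂(empiricalMeasure w)
      ≤ K⁻¹ * ∫ y, ‖y.2‖ ^ 4 ∂(empiricalMeasure w) := by
  rw [integral_empiricalMeasure, integral_empiricalMeasure, mul_left_comm]
  refine mul_le_mul_of_nonneg_left ?_ (by positivity)
  rw [Finset.mul_sum]
  refine Finset.sum_le_sum fun i _ => ?_
  split_ifs with h
  · rw [inv_mul_eq_div, le_div_iff₀ hK]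
    calc ‖(w i).2‖ ^ 3 * K ≤ ‖(w i).2‖ ^ 3 * ‖(w i).2‖ :=
          mul_le_mul_of_nonneg_left h.le (pow_nonneg (norm_nonneg _) 3)
      _ = ‖(w i).2‖ ^ 4 := by ring
  · positivity

/-! ## Composition: the two stubs give the crux BY NAME -/

/-- **`stub_initialQuarticMoment → stub_quarticPropagation → CubicMomentUI`** (hypotheses = the two
registered stub statements BY NAME; kernel-checked, no `sorry`): `σ₀ := min σ₀¹ σ₀²`; given
`t, δ`, take `A, B, N₀` from stub 2 and `C₀` from stub 1, `K₀ := (e^{At}C₀ + Bt)/δ + 1`; then for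
`N ≥ N₀`, `s ≤ t`: `E[cubic tail] ≤ K₀⁻¹ Q_N(s) ≤ K₀⁻¹ (e^{At} C₀ + B t) ≤ δ`. -/
theorem CubicMomentUI_of (h1 : stub_initialQuarticMoment) (h2 : stub_quarticPropagation) :
    Summit.AtomisticToContinuum.HydrodynamicLimit.Theses.HeatBathForgetting.CubicMomentUI := by
  intro a₀ θ₀ u₀ ha hθ hu ha0 hθ0
  obtain ⟨σ₁, hσ₁, H1⟩ :=
    (h1 : type_of% Holds.stub_initialQuarticMoment) a₀ θ₀ u₀ ha hθ hu ha0 hθ0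
  obtain ⟨σ₂, hσ₂, H2⟩ :=
    (h2 : type_of% Holds.stub_quarticPropagation) a₀ θ₀ u₀ ha hθ hu ha0 hθ0
  refine ⟨min σ₁ σ₂, lt_min hσ₁ hσ₂, ?_⟩
  intro σ hσ hσlt T ρ θ u hsol Φ h0 t ht δ hδ
  obtain ⟨C₀, hC₀, HQ0⟩ := H1 σ hσ (hσlt.trans_le (min_le_left _ _))
  obtain ⟨A, hA, B, hB, N₀, HQ⟩ :=
    H2 σ hσ (hσlt.trans_le (min_le_right _ _)) T ρ θ u hsol Φ h0 t ht
  have ht0 : 0 ≤ t := ht.1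
  have hM0 : 0 ≤ Real.exp (A * t) * C₀ + B * t := by positivity
  set K : ℝ := (Real.exp (A * t) * C₀ + B * t) / δ + 1 with hK_def
  have hKpos : 0 < K := by rw [hK_def]; positivity
  refine ⟨K, N₀, fun N hN s hs => ?_⟩
  have hs0 : 0 ≤ s := hs.1
  -- Chebyshev, configuration by configuration
  have hcheb : ∀ z : Config (N + 1) (Fin 3) T3,
      ENNReal.ofReal (∫ y, (if K < ‖y.2‖ then ‖y.2‖ ^ 3 else 0) ∂(empiricalMeasure ((Φ N).flow s z)))
        ≤ ENNReal.ofReal K⁻¹ *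
          ENNReal.ofReal (∫ y, ‖y.2‖ ^ 4 ∂(empiricalMeasure ((Φ N).flow s z))) := fun z => by
    rw [← ENNReal.ofReal_mul (inv_nonneg.2 hKpos.le)]
    exact ENNReal.ofReal_le_ofReal (integral_cubicTail_le_quartic _ hKpos)
  -- monotonicity in `s ≤ t` of the Gronwall envelope
  have hexp : ENNReal.ofReal (Real.exp (A * s)) ≤ ENNReal.ofReal (Real.exp (A * t)) :=
    ENNReal.ofReal_le_ofReal (Real.exp_le_exp.2 (mul_le_mul_of_nonneg_left hs.2 hA))
  have hBs : ENNReal.ofReal (B * s) ≤ ENNReal.ofReal (B * t) :=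
    ENNReal.ofReal_le_ofReal (mul_le_mul_of_nonneg_left hs.2 hB)
  -- the final real-number bookkeeping: `K⁻¹ (e^{At} C₀ + B t) ≤ δ`
  have hfin : K⁻¹ * (Real.exp (A * t) * C₀ + B * t) ≤ δ := by
    have hle : Real.exp (A * t) * C₀ + B * t ≤ K * δ := by
      rw [hK_def, add_mul, one_mul, div_mul_cancel₀ _ hδ.ne']
      linarith
    calc K⁻¹ * (Real.exp (A * t) * C₀ + B * t) ≤ K⁻¹ * (K * δ) :=
          mul_le_mul_of_nonneg_left hle (inv_nonneg.2 hKpos.le)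
      _ = δ := by rw [← mul_assoc, inv_mul_cancel₀ hKpos.ne', one_mul]
  calc ∫⁻ z, ENNReal.ofReal (∫ y, (if K < ‖y.2‖ then ‖y.2‖ ^ 3 else 0)
          ∂(empiricalMeasure ((Φ N).flow s z))) ∂(localGibbsLaw σ a₀ u₀ θ₀ N (Φ N))
      ≤ ∫⁻ z, ENNReal.ofReal K⁻¹ *
          ENNReal.ofReal (∫ y, ‖y.2‖ ^ 4 ∂(empiricalMeasure ((Φ N).flow s z)))
            ∂(localGibbsLaw σ a₀ u₀ θ₀ N (Φ N)) := lintegral_mono hcheb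
    _ = ENNReal.ofReal K⁻¹ * ∫⁻ z,
          ENNReal.ofReal (∫ y, ‖y.2‖ ^ 4 ∂(empiricalMeasure ((Φ N).flow s z)))
            ∂(localGibbsLaw σ a₀ u₀ θ₀ N (Φ N)) :=
        lintegral_const_mul' _ _ ENNReal.ofReal_ne_top
    _ ≤ ENNReal.ofReal K⁻¹ * (ENNReal.ofReal (Real.exp (A * s)) *
          (∫⁻ z, ENNReal.ofReal (∫ y, ‖y.2‖ ^ 4 ∂(empiricalMeasure z))
            ∂(localGibbsLaw σ a₀ u₀ θ₀ N (Φ N))) + ENNReal.ofReal (B * s)) :=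
        mul_le_mul' le_rfl (HQ N hN s hs)
    _ ≤ ENNReal.ofReal K⁻¹ * (ENNReal.ofReal (Real.exp (A * t)) * ENNReal.ofReal C₀ +
          ENNReal.ofReal (B * t)) :=
        mul_le_mul' le_rfl (add_le_add (mul_le_mul' hexp (HQ0 N (Φ N))) hBs)
    _ = ENNReal.ofReal (K⁻¹ * (Real.exp (A * t) * C₀ + B * t)) := by
        rw [ENNReal.ofReal_mul (inv_nonneg.2 hKpos.le),
          ENNReal.ofReal_add (by positivity) (by positivity),
          ENNReal.ofReal_mul (Real.exp_pos _).le]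
    _ ≤ ENNReal.ofReal δ := ENNReal.ofReal_le_ofReal hfin

end Summit.AtomisticToContinuum.HydrodynamicLimit.Cruxes.CubicMomentUI.Birth

end
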